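import Summits.QuantumFields.YangMills.Theorems.BalabanUVNodesN11AFibreRowOfNesting
import Summits.QuantumFields.YangMills.Theorems.BalabanUVNodesN11OneBlockLevels

/-!
# DAG node N11 — THE A-FIBRE DOMINATION ROW WITHOUT THE RUN GUARD: the saturation `hsat` of the generation-`j` A-fibre region `Λ_{j+1}ᶜ ∩ Ω_{j+1}` and dag-n11-w1's two
# A-fibre domination rows hold at EVERY history of EVERY run from the nesting numeric `L·M₂ ∣ M` and `M = L^a` ALONE (each level is compatible OR one-block) — hence
# UNCONDITIONALLY at every H-extension of K1's witness of record `θ₁₅ᶜᶜᴹᵂ(j; γ)`, `j ≥ 1`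

HEADER — WORK-UNIT METADATA.  Cell `pub-ymgap`, YM-PLAN Track A (HUMAN RULING D-0062 ∕ D-0149 ∕ D-0154 width seats), seat `pub-ymgap-dag-n11-w5` (g2; WIDTH SEAT 5 on NODE n11
[B14]; self-located CLAIM-1 in this seat's own X7 lineage, INBOX l.31969, ACKed «YOURS» by dag-n11-w4 g4 l.32054), route `BalabanUVNodes`, item K1⁷ `StabilityBAtRecordR13SepCoPH` =
stmt-QuantumFields-20542 (helper lane, `--kind proof --supports 20542 --as helper`, count-neutral).  [III] = [Balaban1988Convergent], [I] = [Balaban1987RG1].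
PROVENANCE: the text of §1–§2 was DRAFTED BY dag-n11-w4 g4 (its unfiled would-be INTENT-5 `…AFibreRowOfNestingOfPowM`, HOME twin `pub-ymgap-dag-n11-w4/lean/g4/`, gifted on the bus
l.32054 «take any line of it freely») and is adopted here VERBATIM up to the namespace; §3 (the witness editions) is this seat's.  Over this seat's g0 p610048 `…N11AFibreRowOfNesting` (X7:
`mem_unionsOfCubes_compl_inter`, `sideD_eq_sideχ_mul`, the two `_of_partCompat_of_nesting` rows over dag-n11-w1's `…AFibreDominationRowCubeCover` faces `afibre_dominated_rePinH_of_saturated` ∕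
`afibre_dominated_of_saturated_of_quad_nonneg`) and dag-n11-w4 g4's `…N11OneBlockLevels` (`dCubeSide_dvd_or_lt`, `eq_empty_or_eq_univ_of_mem_unionsOfCubes_of_le`,
`mem_unionsOfCubes_of_mem_unionsOfCubes_mul_of_dvd_or_le`), with dag-n21-c's `K0TopIndexWrapGeometry.univ_mem_unionsOfCubes` and `Node00.empty_mem_unionsOfCubes` cited BY NAME.

WHY THIS FILE.  X7 (p610048) derived dag-n11-w1's saturation binder `hsat : Λ_{j+1}(init s)ᶜ ∩ Ω_{j+1}(init s) ∈ unionsOfCubes (F.P p.K) (sideχ … j)` from the RUN GUARD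
`hPC : PartCompat₁₃ θ p k` (every 𝐃-grid up to level `k` divides the torus) and the nesting numeric `L·M₂ ∣ M`.  dag-n11-w4 g4 LOCATED that the guard is a FLOOR ON THE COUPLING
(`…N11RunGuardIsCouplingFloor`): the windowed runs of K1⁷'s consequent include runs BELOW it, where `PartCompat₁₃` fails — so a row keyed on `hPC` is silent exactly where [III] p.257
«we assume that all partitions are compatible» assumes the problem away.  But the GEOMETRY never needed the guard (`…N11OneBlockLevels`): at `θ.τ9.M = F.L^a` the 𝐃_{j+1}-side
`L^{j+1}·M·R_{j+1}` is a power of `L` (`R = L^s` by (2.5)) and the period is `2·L^{m+K}`, so level `j+1` is EITHER compatible — X7's argument verbatim (complement ∕ intersection of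
unions of χ_{j+1}-cubes, the χ-grid dividing the torus as a divisor of the 𝐃-grid) — OR ONE-BLOCK: the 𝐃_{j+1}-grid has the single index `0`, its cube IS the torus, so (2.1) puts
`Λ_{j+1}(init s)` and `Ω_{j+1}(init s)` in `{∅, T_η}`, and `Λᶜ ∩ Ω ∈ {∅, T_η}` is a union of χ_{j+1}-cubes trivially (`T_η` is the union of ALL cubes of any positive side).  Off the
window (`k < j+1`) the region is `∅` as in X7.  Hence (§1) `hsat` and (§2) both rows with `hPC` DELETED — `hMa : θ.τ9.M = F.L^a` instead — at EVERY history of EVERY run, above or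
below the floor; and (§3) at every H-extension `θ` of K1's witness of record `θ₁₅ᶜᶜᴹᵂ(j; γ)` (`θ.toStage13Params = theta13OfThm1CCMW …`, `1 ≤ j`: `M = L^j`, `M₂ = 1` are
dag-n21-c's `rfl` letters, `L·1 ∣ L^j`, `1 ≤ L` from `11 < L`) the saturation and the certificate row hold with NO numeric hypothesis left.  CONSEQUENCE (dag-n11-w4 g4 LOCATED
l.32054, first-hand `rg`): of the three consumers of `hPC` in dag-n11-d's no-expansion faces — the cube cover `hcov` (freed by `cover_row_of_nesting_of_powM`), X7's `hsat` (freed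
HERE), and K0's proviso row `bg` — only the ANALYTIC row `bg` (regularity of the background of record, (2.28)) still reads the guard.

WHAT THIS FILE PROVES (0 `sorry`, 0 `def`; composition BY NAME; nothing of Bałaban asserted).
§1 (generic `θ : Stage13HParams`, `hdiv : L·M₂ ∣ M`, `hMa : θ.τ9.M = F.L^a`): `sideD_dvd_or_lt_of_powM` · `sideχ_pos_of_nesting_of_powM` · ★ `Λ_init_mem_unionsOfCubes_sideχ_of_powM` ·
   ★ `Ω_init_mem_unionsOfCubes_sideχ_of_powM` · ★★ `saturated_ΛcΩ_of_nesting_of_powM` (= X7's `saturated_ΛcΩ_of_partCompat_of_nesting` with `hPC` DELETED).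
§2 ★★ `afibre_dominated_of_quad_nonneg_of_nesting_of_powM` · ★★ `afibre_dominated_rePinH_of_nesting_of_powM` (= X7 §3 with `hPC` DELETED; dag-n11-w1's conclusions VERBATIM).
§3 (at K1's witness of record, every H-extension, `1 ≤ j`; NO numeric hypothesis): `nesting_of_eq_theta13OfThm1CCMW` · ★★ `saturated_ΛcΩ_of_eq_theta13OfThm1CCMW` ·
   ★★★ `afibre_dominated_rePinH_of_eq_theta13OfThm1CCMW` (the (K0b) A-fibre domination conjunct of dag-n11-e's `ResidualRowsAt` at the certificate `rePinH θ`, on every all-small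
   branch `S_{i+1} = ∅`, at EVERY history of EVERY run — UNCONDITIONAL) · ★★ `afibre_dominated_of_quad_nonneg_of_eq_theta13OfThm1CCMW` (generic-weight edition under [I]'s sign `0 ≤ quad`).

HONEST FRAMING.  Helper lane of K1⁷; count-neutral kernel bookkeeping (torus ∕ lattice set algebra over landed lemmas); NOT a discharge; no law of record edited or posited.
`L·M₂ ∣ M` and `M = L^a` are HYPOTHESES in §1–§2 (node00-def-K0a's `M = M₂ = 1` meets the former only at `L = 1`; both are THEOREMS at θ₁₅ᶜᶜᴹᵂ(j; γ), `j ≥ 1`, §3).  N11 NOT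
discharged; K1⁷ NOT closed; counts unmoved (typed 28∕28 · discharged 5∕27); no summit statement is proved by this seat.  R4 closes only the conditional finite-𝕋⁴ rung
`BalabanLadder.UV` of one programme at fixed `ε = L^{−K}` — NOT ℝ⁴, NOT OS, NOT a mass gap, NOT Clay.  No `sorry`, `axiom`, `def`, `instance`, `notation`.
Sources (SHAPE ∕ bookkeeping only): [III] (2.1) p.254 («unions of big cubes»), (2.5) p.255, (2.17)–(2.18) p.257 («compatible with all other partitions»), (2.21) p.258, (3.2) p.265,
(3.16) p.268, (3.21) p.269, (3.23) p.270; [I] (0.1) p.251 (the torus `2L^m∕ε`); [Balaban1989LargeFieldI] (2.1) p.182 (`M = L^j` at the witness).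
-/

noncomputable section

open MeasureTheory
open scoped BigOperators ENNReal NNReal Matrix.Norms.L2Operator

namespace Summit.QuantumFields.YangMills.Theorems.BalabanUVNodesN11AFibreRowOneBlock

open Literature.MathematicalPhysics.QuantumFieldTheory.Balaban1983to89 T4Continuum Node00 Node00.Tk
open B10Eq42TorusConstraint (bondsIn)
open BalabanUVNodesN11RePinnedParamDefs
open BalabanUVNodesN11AFibreDominationRowCubeCover (afibre_dominated_rePinH_of_saturated afibre_dominated_of_saturated_of_quad_nonneg)
open BalabanUVNodesN11CubeCoverRowOfNesting (dCubeSide_eq_cubeSide_mul)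
open BalabanUVNodesN11AFibreRowOfNesting (sideD_eq_sideχ_mul mem_unionsOfCubes_compl_inter)
open BalabanUVNodesN11OneBlockLevels (dCubeSide_dvd_or_lt eq_empty_or_eq_univ_of_mem_unionsOfCubes_of_le mem_unionsOfCubes_of_mem_unionsOfCubes_mul_of_dvd_or_le)
open Summit.QuantumFields.YangMills.Theorems.K0TopIndexWrapGeometry (univ_mem_unionsOfCubes)

section Generic

variable {F : T4Family} {N : ℕ} [NeZero N]
variable (θ : Stage13HParams F N) (p : B12.RunParams)

/-! ## §1  The saturation of the A-fibre region at every history, compatible or one-block -/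

section Saturation

/-- **THE 𝐃_{j+1}-GRID IS COMPATIBLE OR ONE-BLOCK** at `θ.τ9.M = F.L^a` (`…OneBlockLevels.dCubeSide_dvd_or_lt` one level up, in X7's letter `sideD`).
[cite: Balaban1988Convergent, (2.1) p.254, (2.5) p.255, p.257] -/
theorem sideD_dvd_or_lt_of_powM {a : ℕ} (hMa : θ.τ9.M = F.L ^ a) (j : ℕ) :
    sideD F θ.ν θ.τ9.M p (gOfRecord₁₃ F N θ.toStage13Params p) j ∣ (F.P p.K).sitesPerDir 0 ∨
      (F.P p.K).sitesPerDir 0 < sideD F θ.ν θ.τ9.M p (gOfRecord₁₃ F N θ.toStage13Params p) j :=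
  dCubeSide_dvd_or_lt θ.toStage13Params hMa p (j + 1)

/-- The χ_{j+1}-side is positive at `M = L^a` with `L·M₂ ∣ M` (`sideD = sideχ·t` is a power of `L`). [cite: Balaban1988Convergent, (2.17) p.257, (3.2) p.265 (bookkeeping)] -/
theorem sideχ_pos_of_nesting_of_powM (hdiv : (F.P p.K).L * θ.ν.M₂ ∣ θ.τ9.M) {a : ℕ} (hMa : θ.τ9.M = F.L ^ a) (j : ℕ) :
    0 < sideχ F θ.ν p (gOfRecord₁₃ F N θ.toStage13Params p) j := by
  obtain ⟨t, ht⟩ := hdiv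
  have hside := sideD_eq_sideχ_mul (F := F) θ.ν p (gOfRecord₁₃ F N θ.toStage13Params p) ht j
  rcases Nat.eq_zero_or_pos (sideχ F θ.ν p (gOfRecord₁₃ F N θ.toStage13Params p) j) with h0 | h0
  · exfalso
    have hD : sideD F θ.ν θ.τ9.M p (gOfRecord₁₃ F N θ.toStage13Params p) j = 0 := by rw [hside, h0, zero_mul]
    have hpos : 0 < sideD F θ.ν θ.τ9.M p (gOfRecord₁₃ F N θ.toStage13Params p) j := by
      unfold sideD dCubeSide
      have hL : 0 < (F.P p.K).L := by rw [T4Family.P_L]; have := F.hL11; omega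
      have hM : 0 < θ.τ9.M := by rw [hMa]; have := F.hL11; positivity
      have hR : 0 < RkOfRecord (F.P p.K).L θ.ν.r (gOfRecord₁₃ F N θ.toStage13Params p (j + 1)) := by
        obtain ⟨s, hs, -, -⟩ := isRj_RkOfRecord (by rw [T4Family.P_L]; have := F.hL11; omega : 2 ≤ (F.P p.K).L) θ.ν.r
          (gOfRecord₁₃ F N θ.toStage13Params p (j + 1))
        rw [hs]; positivity
      positivity
    omega
  · exact h0

/-- **★ `Λ_{j+1}(init s)` IS A UNION OF χ_{j+1}-CUBES ON THE WINDOW `j+1 ≤ k` — NO RUN GUARD** (= X7's `Λ_init_mem_unionsOfCubes_sideχ` with `hPC ↦ hMa`).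
[cite: Balaban1988Convergent, (2.1) p.254, (2.5) p.255, (2.17) p.257, (3.2) p.265] -/
theorem Λ_init_mem_unionsOfCubes_sideχ_of_powM (hdiv : (F.P p.K).L * θ.ν.M₂ ∣ θ.τ9.M) {a : ℕ} (hMa : θ.τ9.M = F.L ^ a) {k : ℕ}
    (s : SeqOfRecord F θ.ν θ.τ9.M (gOfRecord₁₃ F N θ.toStage13Params p) p.K (k + 1)) {j : ℕ} (hjk : j + 1 ≤ k) :
    s.init.Λ (j + 1) ∈ unionsOfCubes (F.P p.K) (sideχ F θ.ν p (gOfRecord₁₃ F N θ.toStage13Params p) j) := by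
  have hpos := sideχ_pos_of_nesting_of_powM θ p hdiv hMa j
  obtain ⟨t, ht⟩ := hdiv
  have hside := sideD_eq_sideχ_mul (F := F) θ.ν p (gOfRecord₁₃ F N θ.toStage13Params p) ht j
  have hΛ : s.init.Λ (j + 1) ∈ unionsOfCubes (F.P p.K) (sideχ F θ.ν p (gOfRecord₁₃ F N θ.toStage13Params p) j * t) := by
    rw [← hside]; exact s.init.chain.memΛ (j + 1) (Nat.succ_pos j) hjk
  have hcases := sideD_dvd_or_lt_of_powM θ p hMa j
  rw [hside] at hcases
  exact mem_unionsOfCubes_of_mem_unionsOfCubes_mul_of_dvd_or_le hpos (hcases.imp id le_of_lt) hΛ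

/-- **★ `Ω_{j+1}(init s)` IS A UNION OF χ_{j+1}-CUBES ON THE WINDOW `j+1 ≤ k` — NO RUN GUARD** (= X7's `Ω_init_mem_unionsOfCubes_sideχ` with `hPC ↦ hMa`).
[cite: Balaban1988Convergent, (2.1) p.254, (2.5) p.255, (2.17) p.257, (3.2) p.265] -/
theorem Ω_init_mem_unionsOfCubes_sideχ_of_powM (hdiv : (F.P p.K).L * θ.ν.M₂ ∣ θ.τ9.M) {a : ℕ} (hMa : θ.τ9.M = F.L ^ a) {k : ℕ}
    (s : SeqOfRecord F θ.ν θ.τ9.M (gOfRecord₁₃ F N θ.toStage13Params p) p.K (k + 1)) {j : ℕ} (hjk : j + 1 ≤ k) :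
    s.init.Ω (j + 1) ∈ unionsOfCubes (F.P p.K) (sideχ F θ.ν p (gOfRecord₁₃ F N θ.toStage13Params p) j) := by
  have hpos := sideχ_pos_of_nesting_of_powM θ p hdiv hMa j
  obtain ⟨t, ht⟩ := hdiv
  have hside := sideD_eq_sideχ_mul (F := F) θ.ν p (gOfRecord₁₃ F N θ.toStage13Params p) ht j
  have hΩ : s.init.Ω (j + 1) ∈ unionsOfCubes (F.P p.K) (sideχ F θ.ν p (gOfRecord₁₃ F N θ.toStage13Params p) j * t) := by
    rw [← hside]; exact s.init.chain.memΩ (j + 1) (Nat.succ_pos j) hjk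
  have hcases := sideD_dvd_or_lt_of_powM θ p hMa j
  rw [hside] at hcases
  exact mem_unionsOfCubes_of_mem_unionsOfCubes_mul_of_dvd_or_le hpos (hcases.imp id le_of_lt) hΩ

/-- **★★ THE SATURATION `hsat` AT EVERY GENERATION FOR EVERY HISTORY — NO RUN GUARD** (= X7's `saturated_ΛcΩ_of_partCompat_of_nesting` with `hPC ↦ hMa : θ.τ9.M = F.L^a`): the
region `Λ_{j+1}(init s)ᶜ ∩ Ω_{j+1}(init s)` is a union of χ_{j+1}-cubes.  On the window: at a compatible level X7's argument (complement and intersection of unions of grid cubes,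
the χ-grid dividing the torus), at a one-block level both sets are `∅` or the torus; off the window the region is `∅`.
[cite: Balaban1988Convergent, (2.1) p.254, (2.17)–(2.18) p.257, (2.21) p.258, (3.2) p.265, (3.16) p.268; Balaban1987RG1, (0.1) p.251] -/
theorem saturated_ΛcΩ_of_nesting_of_powM (hdiv : (F.P p.K).L * θ.ν.M₂ ∣ θ.τ9.M) {a : ℕ} (hMa : θ.τ9.M = F.L ^ a) {k : ℕ}
    (s : SeqOfRecord F θ.ν θ.τ9.M (gOfRecord₁₃ F N θ.toStage13Params p) p.K (k + 1)) (j : ℕ) :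
    (s.init.Λ (j + 1))ᶜ ∩ s.init.Ω (j + 1) ∈ unionsOfCubes (F.P p.K) (sideχ F θ.ν p (gOfRecord₁₃ F N θ.toStage13Params p) j) := by
  by_cases hjk : j + 1 ≤ k
  · have hpos := sideχ_pos_of_nesting_of_powM θ p hdiv hMa j
    have hΛχ := Λ_init_mem_unionsOfCubes_sideχ_of_powM θ p hdiv hMa s hjk
    have hΩχ := Ω_init_mem_unionsOfCubes_sideχ_of_powM θ p hdiv hMa s hjk
    obtain ⟨t, ht⟩ := hdiv
    have hside := sideD_eq_sideχ_mul (F := F) θ.ν p (gOfRecord₁₃ F N θ.toStage13Params p) ht j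
    rcases sideD_dvd_or_lt_of_powM θ p hMa j with hdvd | hlt
    · -- compatible level: the χ-grid divides the torus too
      rw [hside] at hdvd
      exact mem_unionsOfCubes_compl_inter hpos ((dvd_mul_right _ _).trans hdvd) hΛχ hΩχ
    · -- one-block level: both regions are `∅` or the torus
      have hΛ : s.init.Λ (j + 1) ∈ unionsOfCubes (F.P p.K) (sideD F θ.ν θ.τ9.M p (gOfRecord₁₃ F N θ.toStage13Params p) j) :=
        s.init.chain.memΛ (j + 1) (Nat.succ_pos j) hjk
      have hΩ : s.init.Ω (j + 1) ∈ unionsOfCubes (F.P p.K) (sideD F θ.ν θ.τ9.M p (gOfRecord₁₃ F N θ.toStage13Params p) j) :=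
        s.init.chain.memΩ (j + 1) (Nat.succ_pos j) hjk
      rcases eq_empty_or_eq_univ_of_mem_unionsOfCubes_of_le hlt.le hΩ with hΩ0 | hΩ1
      · rw [hΩ0, Set.inter_empty]; exact Node00.empty_mem_unionsOfCubes _ _
      · rcases eq_empty_or_eq_univ_of_mem_unionsOfCubes_of_le hlt.le hΛ with hΛ0 | hΛ1
        · rw [hΛ0, hΩ1, Set.compl_empty, Set.inter_univ]; exact univ_mem_unionsOfCubes hpos
        · rw [hΛ1, Set.compl_univ, Set.empty_inter]; exact Node00.empty_mem_unionsOfCubes _ _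
  · rw [s.init.Ω_off (j + 1) (fun h => hjk h.2), Set.inter_empty]
    exact Node00.empty_mem_unionsOfCubes _ _

end Saturation

/-! ## §2  dag-n11-w1's two A-fibre domination rows, NO RUN GUARD (X7 §3 with `hPC ↦ hMa`) -/

section Row

/-- **★★ THE ROW FOR THE ALL-SMALL BRANCH VALUE, generic `θ` under [I]'s sign `0 ≤ quad`, AT EVERY HISTORY — NO RUN GUARD** (X7's
`afibre_dominated_of_quad_nonneg_of_partCompat_of_nesting` with `hPC` replaced by `hMa : θ.τ9.M = F.L^a`; everything else VERBATIM).
[cite: Balaban1988Convergent, (2.21) p.258, (3.16) p.268, (3.21) p.269, (2.1) p.254, (2.17) p.257] -/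
theorem afibre_dominated_of_quad_nonneg_of_nesting_of_powM (hL : 1 ≤ (F.P p.K).L) (hM₂ : 1 ≤ θ.ν.M₂)
    (hdiv : (F.P p.K).L * θ.ν.M₂ ∣ θ.τ9.M) {a : ℕ} (hMa : θ.τ9.M = F.L ^ a) {k : ℕ}
    (s : SeqOfRecord F θ.ν θ.τ9.M (gOfRecord₁₃ F N θ.toStage13Params p) p.K (k + 1)) (j : ℕ)
    (hq : ∀ ω : MultiCfg (F.P p.K) (SU N) (FluctV N), 0 ≤ (θ.zhAt p s).quad j (s.init.Λ (j + 1)) ω)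
    (S : ℕ → Set (Site (F.P p.K) 0)) (hS : S (j + 1) = ∅) :
    ∃ ŵ : (↥(Set.toFinite (bondsIn j ((s.init.Λ (j + 1))ᶜ ∩ s.init.Ω (j + 1)))).toFinset → FluctV N) → ℝ≥0∞, Measurable ŵ ∧
      (∫⁻ a, ŵ a ∂(Measure.pi fun _ : ↥(Set.toFinite (bondsIn j ((s.init.Λ (j + 1))ᶜ ∩ s.init.Ω (j + 1)))).toFinset => (volume : Measure (FluctV N)))) ≠ ⊤ ∧
      ∀ ω, ENNReal.ofReal ((WtOfRecord₁₃H F N θ p s).w j (s.init.Λ (j + 1)) ((s.init.Λ (j + 1))ᶜ ∩ s.init.Ω (j + 1)) (S (j + 1)) ω) ≤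
        ŵ (fun b : ↥(Set.toFinite (bondsIn j ((s.init.Λ (j + 1))ᶜ ∩ s.init.Ω (j + 1)))).toFinset => (ω j).2 b) :=
  afibre_dominated_of_saturated_of_quad_nonneg θ p hL hM₂ s j hq (saturated_ΛcΩ_of_nesting_of_powM θ p hdiv hMa s j) S hS

/-- **★★ THE ROW AT THE CERTIFICATE `rePinH θ` FOR THE ALL-SMALL BRANCH VALUE AT EVERY HISTORY — NO RUN GUARD** (X7's `afibre_dominated_rePinH_of_partCompat_of_nesting` with `hPC`
replaced by `hMa : θ.τ9.M = F.L^a`; everything else VERBATIM). [cite: Balaban1988Convergent, (2.21) p.258, (3.16) p.268, (3.21) p.269, (3.23) p.270, (2.1) p.254, (2.17) p.257] -/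
theorem afibre_dominated_rePinH_of_nesting_of_powM (hL : 1 ≤ (F.P p.K).L) (hM₂ : 1 ≤ θ.ν.M₂)
    (hdiv : (F.P p.K).L * θ.ν.M₂ ∣ θ.τ9.M) {a : ℕ} (hMa : θ.τ9.M = F.L ^ a) {k : ℕ}
    (s : SeqOfRecord F θ.ν θ.τ9.M (gOfRecord₁₃ F N θ.toStage13Params p) p.K (k + 1)) (j : ℕ)
    (S : ℕ → Set (Site (F.P p.K) 0)) (hS : S (j + 1) = ∅) :
    ∃ ŵ : (↥(Set.toFinite (bondsIn j ((s.init.Λ (j + 1))ᶜ ∩ s.init.Ω (j + 1)))).toFinset → FluctV N) → ℝ≥0∞, Measurable ŵ ∧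
      (∫⁻ a, ŵ a ∂(Measure.pi fun _ : ↥(Set.toFinite (bondsIn j ((s.init.Λ (j + 1))ᶜ ∩ s.init.Ω (j + 1)))).toFinset => (volume : Measure (FluctV N)))) ≠ ⊤ ∧
      ∀ ω, ENNReal.ofReal ((WtOfRecord₁₃H F N (rePinH θ) p s).w j (s.init.Λ (j + 1)) ((s.init.Λ (j + 1))ᶜ ∩ s.init.Ω (j + 1)) (S (j + 1)) ω) ≤
        ŵ (fun b : ↥(Set.toFinite (bondsIn j ((s.init.Λ (j + 1))ᶜ ∩ s.init.Ω (j + 1)))).toFinset => (ω j).2 b) :=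
  afibre_dominated_rePinH_of_saturated θ p hL hM₂ s j (saturated_ΛcΩ_of_nesting_of_powM θ p hdiv hMa s j) S hS

end Row

end Generic

/-! ## §3  At K1's witness of record `θ₁₅ᶜᶜᴹᵂ(j; γ)` (`M = L^j`, `M₂ = 1`), every H-extension, `1 ≤ j`: the saturation and the rows are UNCONDITIONAL -/

section Witness

variable {F : T4Family} {N : ℕ} [NeZero N] (j : ℕ) (γ ε₀ ε₂₉ B₃ B₃' a₀ a₁ : ℝ)

/-- **THE TWO NUMERIC LETTERS AT ANY H-EXTENSION OF θ₁₅ᶜᶜᴹᵂ(j; γ)**, `1 ≤ j`: `θ.τ9.M = F.L^j`, `1 ≤ θ.ν.M₂` (indeed `= 1`) and the nesting numeric `L·M₂ ∣ M` — dag-n21-c's `rfl` letters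
read through `θ.toStage13Params` (dag-n11-w4's `nesting_theta13OfThm1CCMW` one structure up). [cite: Balaban1989LargeFieldI, (2.1) p.182; Balaban1988Convergent, (2.1) p.254, (2.17) p.257 (bookkeeping witness)] -/
theorem nesting_of_eq_theta13OfThm1CCMW (θ : Stage13HParams F N) (hθ : θ.toStage13Params = theta13OfThm1CCMW F N j γ ε₀ ε₂₉ B₃ B₃' a₀ a₁) (hj : 1 ≤ j) (K : ℕ) :
    θ.τ9.M = F.L ^ j ∧ 1 ≤ θ.ν.M₂ ∧ (F.P K).L * θ.ν.M₂ ∣ θ.τ9.M := by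
  have hM : θ.τ9.M = F.L ^ j := by
    show θ.toStage13Params.τ9.M = F.L ^ j
    rw [hθ]; exact theta13OfThm1CCMW_τ9_M F N j γ ε₀ ε₂₉ B₃ B₃' a₀ a₁
  have hM₂ : θ.ν.M₂ = 1 := by
    show θ.toStage13Params.ν.M₂ = 1
    rw [hθ]; exact theta13OfThm1CCMW_M₂ F N j γ ε₀ ε₂₉ B₃ B₃' a₀ a₁
  refine ⟨hM, by rw [hM₂], ?_⟩
  rw [hM₂, hM, T4Family.P_L, mul_one]
  exact dvd_pow_self F.L (by omega)

/-- **★★ AT θ₁₅ᶜᶜᴹᵂ(j; γ), `1 ≤ j`, dag-n11-w1's SATURATION BINDER `hsat` HOLDS ON EVERY RUN, AT EVERY GENERATION, FOR EVERY HISTORY** — no window, no run guard, no numeric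
hypothesis: every H-extension `θ` with `θ.toStage13Params = θ₁₅ᶜᶜᴹᵂ(j; γ)` inherits `M = L^j` and `L·M₂ ∣ M` (the region reads only `θ.ν`, `θ.τ9.M` and the couplings).
[cite: Balaban1988Convergent, (2.1) p.254, (2.17)–(2.18) p.257, (2.21) p.258, (3.2) p.265, (3.16) p.268; Balaban1987RG1, (0.1) p.251; Balaban1989LargeFieldI, (2.1) p.182] -/
theorem saturated_ΛcΩ_of_eq_theta13OfThm1CCMW (θ : Stage13HParams F N) (hθ : θ.toStage13Params = theta13OfThm1CCMW F N j γ ε₀ ε₂₉ B₃ B₃' a₀ a₁) (hj : 1 ≤ j)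
    (p : B12.RunParams) {k : ℕ} (s : SeqOfRecord F θ.ν θ.τ9.M (gOfRecord₁₃ F N θ.toStage13Params p) p.K (k + 1)) (i : ℕ) :
    (s.init.Λ (i + 1))ᶜ ∩ s.init.Ω (i + 1) ∈ unionsOfCubes (F.P p.K) (sideχ F θ.ν p (gOfRecord₁₃ F N θ.toStage13Params p) i) := by
  obtain ⟨hM, -, hdiv⟩ := nesting_of_eq_theta13OfThm1CCMW j γ ε₀ ε₂₉ B₃ B₃' a₀ a₁ θ hθ hj p.K
  exact saturated_ΛcΩ_of_nesting_of_powM θ p hdiv hM s i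

/-- **★★★ AT θ₁₅ᶜᶜᴹᵂ(j; γ), `1 ≤ j`, THE (K0b) A-FIBRE DOMINATION ROW AT THE CERTIFICATE `rePinH θ` HOLDS ON EVERY ALL-SMALL BRANCH `S_{i+1} = ∅`, AT EVERY HISTORY OF EVERY RUN —
UNCONDITIONAL**: dag-n11-w1's `afibre_dominated_rePinH_of_saturated` with `hsat`, `1 ≤ L`, `1 ≤ M₂` ALL discharged at the witness (§2 + `nesting_of_eq_theta13OfThm1CCMW`); the conclusion
VERBATIM.  So on K1's witness line the A-fibre domination conjunct of dag-n11-e's `ResidualRowsAt` is free at every level, in or below dag-n11-w4's coupling floor.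
[cite: Balaban1988Convergent, (2.21) p.258, (3.16) p.268, (3.21) p.269, (3.23) p.270, (2.1) p.254, (2.17) p.257; Balaban1989LargeFieldI, (2.1) p.182] -/
theorem afibre_dominated_rePinH_of_eq_theta13OfThm1CCMW (θ : Stage13HParams F N) (hθ : θ.toStage13Params = theta13OfThm1CCMW F N j γ ε₀ ε₂₉ B₃ B₃' a₀ a₁) (hj : 1 ≤ j)
    (p : B12.RunParams) {k : ℕ} (s : SeqOfRecord F θ.ν θ.τ9.M (gOfRecord₁₃ F N θ.toStage13Params p) p.K (k + 1)) (i : ℕ)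
    (S : ℕ → Set (Site (F.P p.K) 0)) (hS : S (i + 1) = ∅) :
    ∃ ŵ : (↥(Set.toFinite (bondsIn i ((s.init.Λ (i + 1))ᶜ ∩ s.init.Ω (i + 1)))).toFinset → FluctV N) → ℝ≥0∞, Measurable ŵ ∧
      (∫⁻ a, ŵ a ∂(Measure.pi fun _ : ↥(Set.toFinite (bondsIn i ((s.init.Λ (i + 1))ᶜ ∩ s.init.Ω (i + 1)))).toFinset => (volume : Measure (FluctV N)))) ≠ ⊤ ∧
      ∀ ω, ENNReal.ofReal ((WtOfRecord₁₃H F N (rePinH θ) p s).w i (s.init.Λ (i + 1)) ((s.init.Λ (i + 1))ᶜ ∩ s.init.Ω (i + 1)) (S (i + 1)) ω) ≤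
        ŵ (fun b : ↥(Set.toFinite (bondsIn i ((s.init.Λ (i + 1))ᶜ ∩ s.init.Ω (i + 1)))).toFinset => (ω i).2 b) := by
  obtain ⟨hM, hM₂, hdiv⟩ := nesting_of_eq_theta13OfThm1CCMW j γ ε₀ ε₂₉ B₃ B₃' a₀ a₁ θ hθ hj p.K
  exact afibre_dominated_rePinH_of_nesting_of_powM θ p (by rw [T4Family.P_L]; have := F.hL11; omega) hM₂ hdiv hM s i S hS

/-- **★★ AT θ₁₅ᶜᶜᴹᵂ(j; γ), `1 ≤ j`, THE ROW FOR THE ALL-SMALL BRANCH VALUE AT THE GENERIC WEIGHT under [I]'s sign `0 ≤ quad`** — `hsat`, `1 ≤ L`, `1 ≤ M₂` discharged; `hq` kept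
(it concerns `θ.zhAt`, which the witness's Stage-13 projection does not determine). [cite: Balaban1988Convergent, (2.21) p.258, (3.16) p.268, (3.21) p.269, (2.1) p.254, (2.17) p.257; Balaban1989LargeFieldI, (2.1) p.182] -/
theorem afibre_dominated_of_quad_nonneg_of_eq_theta13OfThm1CCMW (θ : Stage13HParams F N) (hθ : θ.toStage13Params = theta13OfThm1CCMW F N j γ ε₀ ε₂₉ B₃ B₃' a₀ a₁)
    (hj : 1 ≤ j) (p : B12.RunParams) {k : ℕ} (s : SeqOfRecord F θ.ν θ.τ9.M (gOfRecord₁₃ F N θ.toStage13Params p) p.K (k + 1)) (i : ℕ)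
    (hq : ∀ ω : MultiCfg (F.P p.K) (SU N) (FluctV N), 0 ≤ (θ.zhAt p s).quad i (s.init.Λ (i + 1)) ω)
    (S : ℕ → Set (Site (F.P p.K) 0)) (hS : S (i + 1) = ∅) :
    ∃ ŵ : (↥(Set.toFinite (bondsIn i ((s.init.Λ (i + 1))ᶜ ∩ s.init.Ω (i + 1)))).toFinset → FluctV N) → ℝ≥0∞, Measurable ŵ ∧
      (∫⁻ a, ŵ a ∂(Measure.pi fun _ : ↥(Set.toFinite (bondsIn i ((s.init.Λ (i + 1))ᶜ ∩ s.init.Ω (i + 1)))).toFinset => (volume : Measure (FluctV N)))) ≠ ⊤ ∧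
      ∀ ω, ENNReal.ofReal ((WtOfRecord₁₃H F N θ p s).w i (s.init.Λ (i + 1)) ((s.init.Λ (i + 1))ᶜ ∩ s.init.Ω (i + 1)) (S (i + 1)) ω) ≤
        ŵ (fun b : ↥(Set.toFinite (bondsIn i ((s.init.Λ (i + 1))ᶜ ∩ s.init.Ω (i + 1)))).toFinset => (ω i).2 b) := by
  obtain ⟨hM, hM₂, hdiv⟩ := nesting_of_eq_theta13OfThm1CCMW j γ ε₀ ε₂₉ B₃ B₃' a₀ a₁ θ hθ hj p.K
  exact afibre_dominated_of_quad_nonneg_of_nesting_of_powM θ p (by rw [T4Family.P_L]; have := F.hL11; omega) hM₂ hdiv hM s i hq S hS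

end Witness

end Summit.QuantumFields.YangMills.Theorems.BalabanUVNodesN11AFibreRowOneBlock

end
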